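import Summits.ResolutionOfSingularities.ResolutionOfSingularities.Theorems.RadicialJungCleanModelsLens5TFrameCompositionInf
import Summits.ResolutionOfSingularities.ResolutionOfSingularities.Theorems.RadicialJungCleanModelsLens5TFrameModelInfOfThm11
import HarnessLib

/-!
# RadicialJungCleanModelsLens5TFrameCompositionInf — re-threaded through Cossart–Piltant 2019 Thm. 1.1 (i)–(iii) (`_thm11` variants)

Route `RadicialJung`, crux `CleanModels` (stmt-ResolutionOfSingularities-15917), line `Sketch`.  The declarations below are the
tree's theorems of the same names WITHOUT the suffix `_thm11` (file `RadicialJungCleanModelsLens5TFrameCompositionInf.lean`), with the embedded-resolution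
HYPOTHESIS `hEmb` (CJS 2020 Cor. 1.5 shape; skeleton stub `stub_cjs2020Thm14` = F-32) REPLACED by the typed verbatim
Cossart–Piltant 2019 Thm. 1.1 (i)–(iii) `CP2019.CossartPiltant2019Thm11`, through the doubling trick
(`Doubling.hEmb_zeroLocus_of_thm11`, `exists_localRing_monomial_of_thm11_dim`).  Proof bodies are the tree's, verbatim — credit to
the original file and its authors (res-B-lens-5, res-B-lead-1 and workers); only the binder and the threaded call differ.  
OURS; nothing here proves resolution in characteristic `p`.
-/

set_option linter.dupNamespace false -- mandated namespace of this single-conjunct summit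

noncomputable section

section

open IsLocalRing
open Literature.AlgebraicGeometry.Resolution
open Summit.ResolutionOfSingularities.ResolutionOfSingularities.Theorems.RadicialJung.CleanModels
open Summit.ResolutionOfSingularities.ResolutionOfSingularities.Theorems.RadicialJung.CleanModels.Lens5
open Summit.ResolutionOfSingularities.ResolutionOfSingularities.Theorems.RadicialJung.CleanModels.Lens5.PRankTwoCurrency
open Summit.ResolutionOfSingularities.ResolutionOfSingularities.Theorems.RadicialJung.CleanModels.Lens5.PRankTwoAssembly
open Summit.ResolutionOfSingularities.ResolutionOfSingularities.Theorems.RadicialJungCleanModels.Lens5RegularityCriterion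
open Summit.ResolutionOfSingularities.ResolutionOfSingularities.Theorems.RadicialJungCleanModels.Lens5ChartSurjection

namespace Summit.ResolutionOfSingularities.ResolutionOfSingularities.Theorems.RadicialJungCleanModels.Lens5TFrame

/-! ## §H∞ THE COMPOSITION (kernel-checked): PORTS 1′_∞, 2′_∞, §F∞, 3 (verbatim), 4′_∞ and the exit lemma give THEOREM T′_∞'s
slice; T′_fin's slice (rev 3) is the corollary `S` finite, and T′₁'s the corollary `S := Fin p`, `b i := θ^i`. -/

section Composition

open AlgebraicGeometry CategoryTheory

/-- **THEOREM T′_∞'s slice from the ports** — modulo F-02 in LU³ form (`hLU3`, applied to the field `k^p`) and F-32 (`hEmb`).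
SORRY-FREE (composition and every port); data flow = the file header.  `hreg`, `hnd` unused (as in T, T′_fin). [folklore] -/
theorem cleanLU3DefectPRankTwoSepInf_of_ports_thm11 (p : ℕ) [Fact p.Prime]
    (hLU3 : ∀ (k : Type) [Field k], LocalUniformization3 k)
    (h11 : Literature.AlgebraicGeometry.CossartPiltant200819.CP2019.CossartPiltant2019Thm11.{0}) :
    CleanLU3DefectPRankTwoSepInfAt p := by
  intro k _ _ K _ _ O A hAO hAfg hFrac hdimA hreg hdim3 hzd g₀ hg₀ hdefect htd hnd hP2 hsep S b hb hPI
  classical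
  haveI := hFrac
  have hp : p.Prime := Fact.out
  haveI : CharP K p := charP_of_injective_algebraMap (algebraMap k K).injective p
  have hk : ∀ c : k, algebraMap k K c ∈ O := fun c => hAO (A.algebraMap_mem c)
  -- `[K : k·K^p] = p³` (§A)
  have hdimAeq : ringKrullDim A = 3 := ringKrullDim_eq_three_of_locAtCentre O A hAO hdimA hdim3
  have hdeg : Module.finrank (Subfield.closure (Set.range (algebraMap k K) ∪ Set.range (frobenius K p))) K = p ^ 3 :=
    PDegreeSep.pDegreeThreeOfSepGenerated p k K A hAfg hFrac hdimAeq hsep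
  -- §1′_∞ graded data on a common finite support `S₀ ⊆ S` (with `v B_s = 1`)
  obtain ⟨M, hM, hg₀M, hpM, hV, hRG, hBv, x, y, hx, hy, hvx, hvy, hP, t, ht, S₀, cf, hcfM, hcf0, hsum, hcfO⟩ :=
    port_gradedDataInf p O A hAO hAfg g₀ hg₀ hdefect hP2 hdeg b hb hPI
  -- the finite set to monomialise: `x^p`, `y^p` and the non-zero graded coefficients of the generators
  set F : Finset K := (insert (x ^ p) (insert (y ^ p)
    ((t ×ˢ (S₀ ×ˢ (Finset.univ : Finset (Fin p × Fin p)))).image (fun q => cf q.1 q.2)))).filter (fun f => f ≠ 0)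
    with hFdef
  have hFM : ∀ f ∈ F, f ∈ M := by
    intro f hf
    rw [hFdef, Finset.mem_filter, Finset.mem_insert, Finset.mem_insert, Finset.mem_image] at hf
    rcases hf with ⟨rfl | rfl | ⟨q, hq, rfl⟩, -⟩
    · exact hpM x
    · exact hpM y
    · exact hcfM q.1 (Finset.mem_product.mp hq).1 q.2
  have hF0 : ∀ f ∈ F, f ≠ 0 := fun f hf => (Finset.mem_filter.mp hf).2
  have hxpF : x ^ p ∈ F := Finset.mem_filter.mpr ⟨by simp, pow_ne_zero _ hx⟩
  have hypF : y ^ p ∈ F := Finset.mem_filter.mpr ⟨by simp, pow_ne_zero _ hy⟩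
  have hcfF : ∀ a ∈ t, ∀ l, cf a l ≠ 0 → cf a l ∈ F := by
    intro a ha l hne
    have hl : l.1 ∈ S₀ := by_contra fun hl => hne (hcf0 a ha l hl)
    refine Finset.mem_filter.mpr ⟨Finset.mem_insert_of_mem (Finset.mem_insert_of_mem ?_), hne⟩
    exact Finset.mem_image.mpr ⟨(a, l), Finset.mem_product.mpr ⟨ha,
      Finset.mem_product.mpr ⟨hl, Finset.mem_univ _⟩⟩, rfl⟩
  -- §2′_∞ the monomialising `k^p`-model inside `M` (two-field M-side)
  obtain ⟨G₂, C, hG₂O, hC, hApC, hCM, z, hzC, hzv, hz0, hzspan, hmono⟩ :=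
    port_monomialModelInf_thm11 p (hLU3 _) h11 O A hAO hAfg hdimA hdim3 hzd g₀ M hM F hFM hF0
  -- §F∞ the base change `T⁺ = locAtCentre k[G₂] O`, regular with parameters `z`
  obtain ⟨A₂, hA₂O, hA₂fg, hApA₂, hCA₂, hTspan, hreg₂, zT, hzT, hzspanT, hdimT⟩ :=
    basechange_modelInf p O A hAO hAfg hdimA hdim3 hzd t ht M b hb hRG G₂ hG₂O C hC hApC hCM z hzC hzv hzspan
  haveI := hreg₂
  have hTT : locAtCentre C O ≤ locAtCentre A₂.toSubring O := locAtCentre_mono O hCA₂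
  have hBA₂ : ∀ s, algebraMap k K (b s) ∈ A₂ := fun s => A₂.algebraMap_mem (b s)
  have hBT : ∀ s, algebraMap k K (b s) ∈ locAtCentre A₂.toSubring O := fun s => le_locAtCentre _ O (hBA₂ s)
  choose! ε ex hεT hεv hfeq using hmono
  have hzM : ∀ i, z i ∈ M := fun i => hCM _ (hzC i)
  have hzV : ∀ i, ∃ w : K, w ≠ 0 ∧ O.valuation (z i) = O.valuation (w ^ p) := fun i => hV _ (hzM i) (hz0 i)
  have hxA : x ^ p = ε (x ^ p) * ∏ i, z i ^ ex (x ^ p) i := hfeq _ hxpF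
  have hyB : y ^ p = ε (y ^ p) * ∏ i, z i ^ ex (y ^ p) i := hfeq _ hypF
  -- exponent data of the non-zero graded pieces (the `B_s` factor is a unit and is dropped)
  set pieces : Finset (K × (S × (Fin p × Fin p))) :=
    (t ×ˢ (S₀ ×ˢ (Finset.univ : Finset (Fin p × Fin p)))).filter (fun q => cf q.1 q.2 ≠ 0) with hpieces
  set E : Finset ((Fin 3 → ℤ) × (Fin p × Fin p)) := pieces.image (fun q => (ex (cf q.1 q.2), q.2.2)) with hEdef
  have hE : ∀ e ∈ E, O.valuation ((∏ i, z i ^ e.1 i) * (x ^ (e.2.1 : ℕ) * y ^ (e.2.2 : ℕ))) ≤ 1 := by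
    intro e he
    obtain ⟨q, hq, rfl⟩ := Finset.mem_image.mp he
    obtain ⟨hq1, hq2⟩ := Finset.mem_filter.mp hq
    have hat : q.1 ∈ t := (Finset.mem_product.mp hq1).1
    have hF' : cf q.1 q.2 ∈ F := hcfF q.1 hat q.2 hq2
    have hval : O.valuation (cf q.1 q.2 * (algebraMap k K (b q.2.1) * (x ^ (q.2.2.1 : ℕ) * y ^ (q.2.2.2 : ℕ)))) ≤ 1 :=
      (O.valuation_le_one_iff _).mpr (hcfO q.1 hat q.2)
    rw [hfeq _ hF', map_mul, map_mul, map_mul, hεv _ hF', hBv, one_mul, one_mul, ← map_mul] at hval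
    simpa using hval
  -- §3 the toric chart (VERBATIM)
  obtain ⟨ρ, hρ, c, a, b', u, ha, hb', hu, hupos, huzero, hzu, hEu⟩ :=
    port_toricChart p O A hAO hAfg hdimA hdim3 htd hx hy hP z hz0 hzv hzV (ε (x ^ p)) (ε (y ^ p))
      (hεv _ hxpF) (hεv _ hypF) (ex (x ^ p)) (ex (y ^ p)) hxA hyB E hE
  -- (PB0): the value-zero chart monomials involve no `x`, `y`, hence lie in `M`
  have hab0 : ∀ j : Fin 3, ρ ≤ (j : ℕ) → a j = 0 ∧ b' j = 0 := by
    intro j hj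
    obtain ⟨W, hW0, hW⟩ := exists_valuation_prod_zpow_eq O z hzV (c j)
    exact exponents_eq_zero_of_valuation_eq_one O hP (ha j) (hb' j) hW0 hW (by rw [← hu j]; exact huzero j hj)
  have huM : ∀ j : Fin 3, ρ ≤ (j : ℕ) → u j ∈ M := by
    intro j hj
    obtain ⟨ha0, hb0⟩ := hab0 j hj
    rw [hu j, ha0, hb0, pow_zero, pow_zero, mul_one, mul_one]
    exact prod_mem fun i _ => zpow_mem (hzM i) _
  have hu0 : ∀ j, u j ≠ 0 := by
    intro j
    rw [hu j]
    exact mul_ne_zero (Finset.prod_ne_zero_iff.mpr fun i _ => zpow_ne_zero _ (hz0 i))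
      (mul_ne_zero (pow_ne_zero _ hx) (pow_ne_zero _ hy))
  -- the unit factors `α^i β^j` are units of `T⁺`
  have hunit : ∀ (ia ib : ℤ), ε (x ^ p) ^ ia * ε (y ^ p) ^ ib ∈ locAtCentre A₂.toSubring O ∧
      O.valuation (ε (x ^ p) ^ ia * ε (y ^ p) ^ ib) = 1 := fun ia ib =>
    ⟨mul_mem (zpow_mem_locAtCentre (hTT (hεT _ hxpF)) (hεv _ hxpF) ia)
        (zpow_mem_locAtCentre (hTT (hεT _ hypF)) (hεv _ hypF) ib),
      by rw [map_mul, map_zpow₀, map_zpow₀, hεv _ hxpF, hεv _ hypF, one_zpow, one_zpow, one_mul]⟩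
  have hzu' : ∀ i : Fin 3, ∃ (ε' : K) (d : Fin 3 → ℤ), ε' ∈ locAtCentre A₂.toSubring O ∧ O.valuation ε' = 1 ∧
      (∀ j : Fin 3, (j : ℕ) < ρ → 0 ≤ d j) ∧ (∃ j : Fin 3, (j : ℕ) < ρ ∧ 0 < d j) ∧
      ((zT i : K)) = ε' * ∏ j, u j ^ d j := by
    intro i
    obtain ⟨d, ia, ib, hd, hdpos, hzi⟩ := hzu i
    refine ⟨_, d, (hunit ia ib).1, (hunit ia ib).2, hd, hdpos, ?_⟩
    rw [hzT i, hzi]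
  -- the generators of `A` as unit-weighted sums of chart monomials with `d_{<ρ} ≥ 0`
  choose! dE iaE ibE hdE hkerE hmonE using hEu
  have htu' : ∀ a₀ ∈ t, ∃ (ν : ↥(S₀ ×ˢ (Finset.univ : Finset (Fin p × Fin p))) → K)
      (d : ↥(S₀ ×ˢ (Finset.univ : Finset (Fin p × Fin p))) → Fin 3 → ℤ),
      (∀ l, ν l = 0 ∨ (ν l ∈ locAtCentre A₂.toSubring O ∧ O.valuation (ν l) = 1)) ∧
      (∀ l, ∀ j : Fin 3, (j : ℕ) < ρ → 0 ≤ d l j) ∧ a₀ = ∑ l, ν l * ∏ j, u j ^ d l j := by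
    intro a₀ ha₀
    have hmemE : ∀ l : ↥(S₀ ×ˢ (Finset.univ : Finset (Fin p × Fin p))), cf a₀ l ≠ 0 → (ex (cf a₀ l), l.1.2) ∈ E :=
      fun l hne => Finset.mem_image.mpr ⟨(a₀, (l : S × (Fin p × Fin p))),
        Finset.mem_filter.mpr ⟨Finset.mem_product.mpr ⟨ha₀, l.2⟩, hne⟩, rfl⟩
    refine ⟨fun l => if cf a₀ l = 0 then 0 else
        ε (cf a₀ l) * (ε (x ^ p) ^ iaE (ex (cf a₀ l), l.1.2) * ε (y ^ p) ^ ibE (ex (cf a₀ l), l.1.2) *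
          algebraMap k K (b l.1.1)),
      fun l => if cf a₀ l = 0 then 0 else dE (ex (cf a₀ l), l.1.2), ?_, ?_, ?_⟩
    · intro l
      by_cases h0 : cf a₀ l = 0
      · exact Or.inl (by simp [h0])
      · refine Or.inr ?_
        simp only [h0, if_false]
        have hF' := hcfF a₀ ha₀ l h0
        exact ⟨mul_mem (hTT (hεT _ hF')) (mul_mem (hunit _ _).1 (hBT l.1.1)),
          by rw [map_mul, map_mul, hεv _ hF', (hunit _ _).2, hBv, one_mul, one_mul]⟩
    · intro l j hj
      by_cases h0 : cf a₀ l = 0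
      · simp [h0]
      · simp only [h0, if_false]
        exact hdE _ (hmemE l h0) j hj
    · conv_lhs => rw [← hsum a₀ ha₀, ← Finset.sum_coe_sort]
      refine Finset.sum_congr rfl fun l _ => ?_
      by_cases h0 : cf a₀ l = 0
      · simp [h0]
      · simp only [h0, if_false]
        have hF' := hcfF a₀ ha₀ l h0
        have hmon := hmonE _ (hmemE l h0)
        simp only at hmon
        calc cf a₀ l * (algebraMap k K (b l.1.1) * (x ^ (l.1.2.1 : ℕ) * y ^ (l.1.2.2 : ℕ)))
            = (ε (cf a₀ l) * ∏ i, z i ^ ex (cf a₀ l) i) *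
                (algebraMap k K (b l.1.1) * (x ^ (l.1.2.1 : ℕ) * y ^ (l.1.2.2 : ℕ))) := by
              rw [← hfeq _ hF']
          _ = ε (cf a₀ l) * algebraMap k K (b l.1.1) *
                ((∏ i, z i ^ ex (cf a₀ l) i) * (x ^ (l.1.2.1 : ℕ) * y ^ (l.1.2.2 : ℕ))) := by
              ring
          _ = ε (cf a₀ l) * (ε (x ^ p) ^ iaE (ex (cf a₀ l), l.1.2) * ε (y ^ p) ^ ibE (ex (cf a₀ l), l.1.2) *
                algebraMap k K (b l.1.1)) * ∏ j, u j ^ dE (ex (cf a₀ l), l.1.2) j := by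
              rw [hmon]; ring
  -- §G∞ the regular chart algebra and its regular parameter in `M` (graded descent on a finite support)
  obtain ⟨A'', hA''O, hAA'', hA''fg, hreg'', ψ, hψ1, hψ2, hψM⟩ :=
    port_regularParameterInf p O A hAO hAfg hdimA hdim3 hzd M A₂ hA₂O hA₂fg hApA₂ b
      (locAtCentre C O) hCM hTT hTspan hRG hreg₂ zT hzspanT hdimT t ht ρ hρ u hu0 hupos huzero huM hzu' htu'
  -- exit: clean form (3) (VERBATIM)
  obtain ⟨cM, hcM⟩ := (hM _).mp hψM
  exact cleanLUConcl_of_parameter O A A'' hA''O hAA'' hA''fg hreg'' g₀ ψ hψ1 hψ2 cM hcM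

/-- The same with F-02 consumed in its main-theorem form `CossartPiltant2019` (✓ `CossartPiltant2019.lu3`). [folklore] -/
theorem cleanLU3DefectPRankTwoSepInf_of_cossartPiltant2019_thm11 (p : ℕ) [Fact p.Prime]
    (hCP : CossartPiltant2019.{0})
    (h11 : Literature.AlgebraicGeometry.CossartPiltant200819.CP2019.CossartPiltant2019Thm11.{0}) :
    CleanLU3DefectPRankTwoSepInfAt p :=
  cleanLU3DefectPRankTwoSepInf_of_ports_thm11 p (fun k _ => hCP.lu3 k) h11

end Composition

/-! ## §I (rev 2) THEOREM T″ — the slice stated with «`κ_v/k` SEPARABLE» (Mathlib's `Algebra.IsSeparable`) in place of the family `b`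

Bridge B1 (Mac Lane 1939, separable direction) IN KERNEL: if the residue field `κ_v = O/𝔪_v` is separable over `k` (for ANY `k`-algebra
structure on `κ_v` compatible with `k → O → κ_v`), then EVERY `k^p`-linearly independent family of constants is residually `p`-independent along
`v` (§B″ (RPI∞)); the proof is Mathlib's linear disjointness of a separable and a purely inseparable extension
(`IntermediateField.linearDisjoint_of_isPurelyInseparable_of_isSeparable`, applied to `κ_v^p ⊇ k^p` separable and `k ⊇ k^p` purely inseparable
inside `κ_v`, after transporting `κ_v/k` to `κ_v^p/k^p` along the two Frobenius isomorphisms).  Since every field has a `k^p`-basis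
(`exists_pBasisFamilyInf`), T′_∞ yields **T″**: `stub_cleanLU3DefectNonDiscrete` on {(P2)} × {`K/k` separably generated} × {`κ_v/k` separable},
with NO auxiliary family in the statement. -/

open AlgebraicGeometry CategoryTheory in
/-- **THEOREM T″ (kernel-checked)**: F-02 (CP 2019, LU³ form over the field `k^p`) and F-32 give `stub_cleanLU3DefectNonDiscrete` on
{`[Γ : pΓ] = p²`} × {`K/k` separably generated} × {`κ_v/k` separable} for an ARBITRARY ground field `k` of characteristic `p` — no auxiliary
family, no `PerfectField k`, no finiteness of `[k : k^p]`.  OURS · CANDIDATE · counted 0; resolution in char p NOT proved. [folklore] -/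
theorem cleanLU3DefectPRankTwoSepRes_of_cossartPiltant2019_thm11 (p : ℕ) [Fact p.Prime]
    (hCP : CossartPiltant2019.{0})
    (h11 : Literature.AlgebraicGeometry.CossartPiltant200819.CP2019.CossartPiltant2019Thm11.{0}) :
    CleanLU3DefectPRankTwoSepResAt p :=
  cleanLU3DefectPRankTwoSepRes_of_sepInf p (cleanLU3DefectPRankTwoSepInf_of_cossartPiltant2019_thm11 p hCP h11)

end Summit.ResolutionOfSingularities.ResolutionOfSingularities.Theorems.RadicialJungCleanModels.Lens5TFrame

end
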